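import Summits.FinalStateConjecture.FinalStateConjecture.Theorems.EIHFluxBalanceInertialRecessionStubSlaving12JetCalculus
import Literature.Geometry.Lorentzian.KerrSchildCoord

/-!
# Route EIHFluxBalance — `InertialRecession` (E′), line `SketchCleanExcision`, skeleton r13,
# stub `stub_coerMomQuant` (Bs): jets of the first-order modulated model `G + x⁰ · Var`

Helper file for the crux `stmt-FinalStateConjecture-17403`
(`Summit.FinalStateConjecture.FinalStateConjecture.Theses.EIHFluxBalance.InertialRecession`, E′),
registered stub `stub_coerMomQuant` (Bs) of skeleton r13. Pure coordinate calculus on `E4` for a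
field of the form `z ↦ G z + z⁰ · Φ z` (the first-order modulated model of a painted summand,
`Φ = Var` the lab first-variation field):

* `coerMomQ_ricAt_congr` — **locality of the coordinate Ricci form**: fields agreeing near `x`
  have the same `ricAt` at `x`;
* `coerMomQ_jets_add_slice_smul` — at a slice point `x⁰ = 0`: same value as `G`, first jet shifted
  by `dx⁰ ⊗ Φ(x)`, second jet shifted by `v⁰ DΦ(x) + dx⁰ ⊗ DΦ(x)(v)` (product rule);
* `coerMomQ_isMetricOn_add_slice_smul` — if `G` are metric components near `x` and `Φ` is smooth
  and symmetric near `x`, then `G` and `G + x⁰Φ` are metric components on a common neighbourhood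
  of `x` (invertibility is an open condition);
* `coerMomQ_contDiffAt_jets_param` — the 2-jet at a fixed point of a family of fields depending
  smoothly on a parameter depends smoothly on the parameter.

Elementary; no definitions, no named facts, no `sorry`.
-/

set_option linter.dupNamespace false
set_option maxSynthPendingDepth 3

noncomputable section

open Set Function Filter Literature.Geometry.Lorentzian Literature.Geometry.Lorentzian.MetricCoord
open scoped Topology ContDiff

namespace Summit.FinalStateConjecture.FinalStateConjecture.Theorems.SublinearIsFree.Slaving

section General

variable {E : Type*} [NormedAddCommGroup E] [NormedSpace ℝ E]

/-- Metric components restrict to open subsets. [folklore] -/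
theorem coerMomQ_isMetricOn_mono {G : E → E →L[ℝ] E →L[ℝ] ℝ} {V W : Set E}
    (hG : IsMetricOn G V) (hW : IsOpen W) (hWV : W ⊆ V) : IsMetricOn G W where
  isOpen := hW
  contDiffOn := hG.contDiffOn.mono hWV
  symm x hx := hG.symm x (hWV hx)
  isInvertible x hx := hG.isInvertible x (hWV hx)

/-- **Locality of the coordinate Ricci form**: two component fields which agree on a
neighbourhood of `x` have the same Christoffel field near `x`, hence the same curvature and Ricci
form at `x` (`ricAt` is built from `♯ = G⁻¹`, `DG`, and the derivative of `Γ` at the point).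
[cite: ONeill1983, Ch. 3, Lemma 3.52] -/
theorem coerMomQ_ricAt_congr [FiniteDimensional ℝ E] {G₁ G₂ : E → E →L[ℝ] E →L[ℝ] ℝ} {x : E}
    (h : G₁ =ᶠ[𝓝 x] G₂) : ricAt G₁ x = ricAt G₂ x := by
  have hD : fderiv ℝ G₁ =ᶠ[𝓝 x] fderiv ℝ G₂ := h.fderiv
  have hchr : chrAt G₁ =ᶠ[𝓝 x] chrAt G₂ := by
    filter_upwards [h, hD] with y hy hDy
    simp only [chrAt, sharpAt, koszulCLM, hy, hDy]
  have hchrx : chrAt G₁ x = chrAt G₂ x := hchr.eq_of_nhds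
  have hDchr : fderiv ℝ (chrAt G₁) x = fderiv ℝ (chrAt G₂) x := hchr.fderiv_eq
  have hriem : ∀ X Y, riemAt G₁ x X Y = riemAt G₂ x X Y := fun X Y ↦ by
    simp only [riemAt, hchrx, hDchr]
  ext Y Z
  rw [ricAt_apply, ricAt_apply]
  congr 1
  ext X
  simp only [ricciEndo_apply, hriem]

/-- **Smooth parameter dependence of the 2-jet at a point**: if `(p, z) ↦ F p z` is `C^∞` near
`(p₀, x)`, then `p ↦ F p x`, `p ↦ D(F p)(x)` and `p ↦ D²(F p)(x)` are `C^∞` at `p₀`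
(`ContDiffAt.fderiv`). [folklore] -/
theorem coerMomQ_contDiffAt_jets_param {P : Type*} [NormedAddCommGroup P] [NormedSpace ℝ P]
    {F' : Type*} [NormedAddCommGroup F'] [NormedSpace ℝ F'] [CompleteSpace F'] [CompleteSpace E]
    {F : P → E → F'} {p₀ : P} {x : E} (hF : ContDiffAt ℝ ∞ (uncurry F) (p₀, x)) :
    ContDiffAt ℝ ∞ (fun p ↦ F p x) p₀ ∧ ContDiffAt ℝ ∞ (fun p ↦ fderiv ℝ (F p) x) p₀ ∧
      ContDiffAt ℝ ∞ (fun p ↦ fderiv ℝ (fderiv ℝ (F p)) x) p₀ := by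
  have htop : (∞ : WithTop ℕ∞) + 1 ≤ ∞ := by simp
  refine ⟨?_, ?_, ?_⟩
  · exact hF.comp p₀ (contDiffAt_id.prodMk contDiffAt_const)
  · exact ContDiffAt.fderiv (f := F) (g := fun _ ↦ x) hF contDiffAt_const htop
  · -- joint smoothness of `(p, z) ↦ D(F p)(z)` near `(p₀, x)`
    have hF' : ContDiffAt ℝ ∞ (uncurry fun (q : P × E) (w : E) ↦ F q.1 w) ((p₀, x), x) := by
      have hι : ContDiffAt ℝ ∞ (fun r : (P × E) × E ↦ (r.1.1, r.2)) ((p₀, x), x) :=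
        (contDiffAt_fst.comp _ contDiffAt_fst).prodMk contDiffAt_snd
      exact hF.comp ((p₀, x), x) hι
    have hD : ContDiffAt ℝ ∞ (fun q : P × E ↦ fderiv ℝ (F q.1) q.2) (p₀, x) :=
      ContDiffAt.fderiv (f := fun (q : P × E) (w : E) ↦ F q.1 w) (g := fun q : P × E ↦ q.2)
        hF' contDiffAt_snd htop
    exact ContDiffAt.fderiv (f := fun (p : P) (z : E) ↦ fderiv ℝ (F p) z) (g := fun _ ↦ x)
      hD contDiffAt_const htop

end General

/-! ### The first-order modulated model `z ↦ G z + z⁰ · Φ z` -/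

section Slice

variable {F : Type*} [NormedAddCommGroup F] [NormedSpace ℝ F] [CompleteSpace F]

/-- **Jets of the first-order modulated model at a slice point.** For `G`, `Φ` smooth on an open
`W ∋ x` with `x⁰ = 0`, the field `z ↦ G z + z⁰ Φ z` has at `x`: the value `G x`, the first
derivative `DG(x) + dx⁰ ⊗ Φ(x)`, and the second derivative
`D²G(x)(v) + v⁰ DΦ(x) + dx⁰ ⊗ DΦ(x)(v)` (written with a vanishing `dx⁰ ⊗ dx⁰` term, the shape of
the jet hypotheses of the momentum-row lemmas). [folklore] -/
theorem coerMomQ_jets_add_slice_smul {G Φ : E4 → F} {W : Set E4} {x : E4}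
    (hG : ContDiffOn ℝ ∞ G W) (hΦ : ContDiffOn ℝ ∞ Φ W) (hW : IsOpen W) (hx : x ∈ W)
    (hx0 : x 0 = 0) :
    (fun z : E4 ↦ G z + (z 0) • Φ z) x = G x ∧
    fderiv ℝ (fun z : E4 ↦ G z + (z 0) • Φ z) x = fderiv ℝ G x + (E4.dx 0).smulRight (Φ x) ∧
    ∀ v : E4, fderiv ℝ (fderiv ℝ (fun z : E4 ↦ G z + (z 0) • Φ z)) x v =
      fderiv ℝ (fderiv ℝ G) x v + ((E4.dx 0) v • fderiv ℝ Φ x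
        + (E4.dx 0).smulRight (fderiv ℝ Φ x v) + (E4.dx 0) v • (E4.dx 0).smulRight (0 : F)) := by
  set n : E4 →L[ℝ] ℝ := E4.dx 0 with hn
  have hn_apply : ∀ z : E4, n z = z 0 := fun z ↦ rfl
  have hnx : n x = 0 := by rw [hn_apply, hx0]
  -- the product `Ψ z = z⁰ Φ z`
  have hΨ : ContDiffOn ℝ ∞ (fun z : E4 ↦ (z 0) • Φ z) W := (n.contDiff.contDiffOn).smul hΦ
  have hdΦ : ∀ z ∈ W, DifferentiableAt ℝ Φ z := fun z hz ↦
    (hΦ.contDiffAt (hW.mem_nhds hz)).differentiableAt (by simp)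
  have e1 : ∀ z ∈ W, fderiv ℝ (fun z : E4 ↦ (z 0) • Φ z) z =
      (n z) • fderiv ℝ Φ z + n.smulRight (Φ z) := by
    intro z hz
    have h := fderiv_fun_smul (n.differentiableAt) (hdΦ z hz)
    rw [n.fderiv] at h
    exact h
  -- first jet of `Ψ` at `x`
  have hΨ1 : fderiv ℝ (fun z : E4 ↦ (z 0) • Φ z) x = n.smulRight (Φ x) := by
    rw [e1 x hx, hnx, zero_smul, zero_add]
  -- second jet of `Ψ` at `x`
  have hΦ' : ContDiffOn ℝ ∞ (fderiv ℝ Φ) W := hΦ.fderiv_of_isOpen hW (by simp)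
  have hdΦ' : DifferentiableAt ℝ (fderiv ℝ Φ) x :=
    (hΦ'.contDiffAt (hW.mem_nhds hx)).differentiableAt (by simp)
  set L : F →L[ℝ] E4 →L[ℝ] F := ContinuousLinearMap.smulRightL ℝ E4 F n with hL
  have hL_apply : ∀ f : F, L f = n.smulRight f := fun f ↦ by
    ext v; simp [hL]
  have hΨ2 : ∀ v, fderiv ℝ (fderiv ℝ (fun z : E4 ↦ (z 0) • Φ z)) x v =
      n v • fderiv ℝ Φ x + n.smulRight (fderiv ℝ Φ x v) := by
    intro v
    have hev : fderiv ℝ (fun z : E4 ↦ (z 0) • Φ z) =ᶠ[𝓝 x]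
        fun z ↦ (n z) • fderiv ℝ Φ z + L (Φ z) := by
      filter_upwards [hW.mem_nhds hx] with z hz
      rw [e1 z hz, hL_apply]
    rw [hev.fderiv_eq]
    have hA : HasFDerivAt (fun z : E4 ↦ (n z) • fderiv ℝ Φ z)
        ((n x) • fderiv ℝ (fderiv ℝ Φ) x + n.smulRight (fderiv ℝ Φ x)) x :=
      n.hasFDerivAt.smul hdΦ'.hasFDerivAt
    have hB : HasFDerivAt (fun z : E4 ↦ L (Φ z)) (L.comp (fderiv ℝ Φ x)) x :=
      L.hasFDerivAt.comp x (hdΦ x hx).hasFDerivAt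
    rw [(hA.fun_add hB).fderiv, hnx, zero_smul, zero_add]
    simp only [_root_.add_apply, ContinuousLinearMap.smulRight_apply,
      ContinuousLinearMap.coe_comp, comp_apply, hL_apply]
  -- assemble with the jets of the sum
  obtain ⟨h1, h2, -⟩ := fderiv_add_jets hG hΨ hW hx
  refine ⟨?_, ?_, fun v ↦ ?_⟩
  · simp only [hx0, zero_smul, add_zero]
  · rw [h1, hΨ1]
  · have hzero : n v • n.smulRight (0 : F) = 0 := by
      ext w; simp
    rw [h2, _root_.add_apply, hΨ2 v, hzero, add_zero]

/-- **The modulated model is a field of metric components near a slice point.** If `G` are metric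
components on `V ∋ x`, `x⁰ = 0`, and `Φ` is smooth with symmetric values on an open `U ∋ x`, then
on some open `V' ∋ x` inside `V ∩ U` both `G` and `z ↦ G z + z⁰ Φ z` are metric components
(smooth, symmetric; invertibility of `G x + 0` persists nearby). [folklore] -/
theorem coerMomQ_isMetricOn_add_slice_smul {G Φ : E4 → E4 →L[ℝ] E4 →L[ℝ] ℝ} {V U : Set E4}
    {x : E4} (hG : IsMetricOn G V) (hx : x ∈ V) (hx0 : x 0 = 0) (hΦ : ContDiffOn ℝ ∞ Φ U)
    (hU : IsOpen U) (hxU : x ∈ U) (hsymm : ∀ z ∈ U, ∀ v w : E4, Φ z v w = Φ z w v) :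
    ∃ V' : Set E4, IsOpen V' ∧ x ∈ V' ∧ V' ⊆ V ∧ V' ⊆ U ∧ IsMetricOn G V' ∧
      IsMetricOn (fun z : E4 ↦ G z + (z 0) • Φ z) V' := by
  set G₁ : E4 → E4 →L[ℝ] E4 →L[ℝ] ℝ := fun z ↦ G z + (z 0) • Φ z with hG₁
  have hW : IsOpen (V ∩ U) := hG.isOpen.inter hU
  have hΨ : ContDiffOn ℝ ∞ (fun z : E4 ↦ (z 0) • Φ z) (V ∩ U) :=
    ((E4.dx 0).contDiff.contDiffOn).smul (hΦ.mono inter_subset_right)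
  have hG₁c : ContDiffOn ℝ ∞ G₁ (V ∩ U) := (hG.contDiffOn.mono inter_subset_left).add hΨ
  -- the invertibility locus
  set T : Set (E4 →L[ℝ] E4 →L[ℝ] ℝ) :=
    range ((↑) : (E4 ≃L[ℝ] (E4 →L[ℝ] ℝ)) → E4 →L[ℝ] E4 →L[ℝ] ℝ) with hT
  have hTo : IsOpen T := ContinuousLinearEquiv.isOpen
  set V' : Set E4 := (V ∩ U) ∩ G₁ ⁻¹' T with hV'
  have hV'o : IsOpen V' := hG₁c.continuousOn.isOpen_inter_preimage hW hTo
  have hxV' : x ∈ V' := by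
    refine ⟨⟨hx, hxU⟩, ?_⟩
    show G₁ x ∈ T
    have h0 : G₁ x = G x := by simp only [hG₁, hx0, zero_smul, add_zero]
    rw [h0]
    obtain ⟨e, he⟩ := hG.isInvertible x hx
    exact ⟨e, he⟩
  refine ⟨V', hV'o, hxV', fun z hz ↦ hz.1.1, fun z hz ↦ hz.1.2,
    coerMomQ_isMetricOn_mono hG hV'o fun z hz ↦ hz.1.1, ?_⟩
  exact
    { isOpen := hV'o
      contDiffOn := hG₁c.mono inter_subset_left
      symm := fun z hz v w ↦ by
        simp only [hG₁, _root_.add_apply, FunLike.coe_smul,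
          Pi.smul_apply, smul_eq_mul, hG.symm z hz.1.1 v w, hsymm z hz.1.2 v w]
      isInvertible := fun z hz ↦ by
        obtain ⟨e, he⟩ := hz.2
        exact ⟨e, he⟩ }

end Slice

/-! ### The painted summand as a smooth function of (frame, lab point) -/

/-- **The painted summand `(S, z) ↦ g_{M,a}(Sz)(S·, S·)` is `C^∞` jointly** in the frame operator
`S` and the lab point `z`, wherever `r(Sz) > 0`. [cite: KerrSchild1965, §3] -/
theorem coerMomQ_contDiffAt_painted (M a : ℝ) {q₀ : (E4 →L[ℝ] E4) × E4}
    (hq₀ : 0 < Kerr.radius a (q₀.1 q₀.2)) :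
    ContDiffAt ℝ ∞ (fun q : (E4 →L[ℝ] E4) × E4 ↦
      (Kerr.bilin M a (q.1 q.2)).bilinearComp q.1 q.1) q₀ := by
  have hS : ContDiffAt ℝ ∞ (fun q : (E4 →L[ℝ] E4) × E4 ↦ q.1) q₀ := contDiffAt_fst
  have hSz : ContDiffAt ℝ ∞ (fun q : (E4 →L[ℝ] E4) × E4 ↦ q.1 q.2) q₀ :=
    contDiffAt_fst.clm_apply contDiffAt_snd
  have hK : ContDiffAt ℝ ∞ (fun q : (E4 →L[ℝ] E4) × E4 ↦ Kerr.bilin M a (q.1 q.2)) q₀ :=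
    ContDiffAt.comp (g := Kerr.bilin M a) (f := fun q : (E4 →L[ℝ] E4) × E4 ↦ q.1 q.2) q₀
      (Kerr.contDiffAt_bilin M a hq₀) hSz
  have h1 : ContDiffAt ℝ ∞ (fun q : (E4 →L[ℝ] E4) × E4 ↦ (Kerr.bilin M a (q.1 q.2)).comp q.1) q₀ :=
    hK.clm_comp hS
  have h2 := ContDiffAt.continuousLinearMap_comp (G := (E4 →L[ℝ] ℝ) →L[ℝ] (E4 →L[ℝ] ℝ))
    ((ContinuousLinearMap.compL ℝ E4 E4 ℝ).flip) hS
  have h3 := h2.clm_comp h1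
  have hfun : (fun q : (E4 →L[ℝ] E4) × E4 ↦ (Kerr.bilin M a (q.1 q.2)).bilinearComp q.1 q.1) =
      fun q ↦ ((ContinuousLinearMap.compL ℝ E4 E4 ℝ).flip q.1).comp
        ((Kerr.bilin M a (q.1 q.2)).comp q.1) := by
    funext q; ext v w; simp
  rw [hfun]
  exact h3

/-- **Registered one-line carrier form** (`coerMomQ_ricAt_congr_bs`) of `coerMomQ_ricAt_congr` on
`E4`: locality of the coordinate Ricci form. [cite: ONeill1983, Ch. 3, Lemma 3.52] -/
theorem coerMomQ_ricAt_congr_bs : open Literature.Geometry.Lorentzian Filter Topology in ∀ {G₁ G₂ : E4 → E4 →L[ℝ] E4 →L[ℝ] ℝ} {x : E4}, G₁ =ᶠ[𝓝 x] G₂ → MetricCoord.ricAt G₁ x = MetricCoord.ricAt G₂ x :=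
  fun h ↦ coerMomQ_ricAt_congr h

end Summit.FinalStateConjecture.FinalStateConjecture.Theorems.SublinearIsFree.Slaving

end
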